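import Mathlib.Logic.Relation
import Mathlib.Logic.Equiv.Fin.Rotate
import Mathlib.Algebra.BigOperators.Group.Finset.Basic
import Mathlib.Algebra.Group.Int.Units
import Mathlib.Data.Sign.Defs
import Mathlib.LinearAlgebra.Matrix.Determinant.Basic
import Mathlib.LinearAlgebra.Matrix.Notation
import Mathlib.Analysis.Calculus.Deriv.Basic
import Mathlib.Geometry.Manifold.Instances.Sphere
import Literature.Topology.FourManifolds.Knots
import HarnessLib

-- provenance: harness21/H21/H21/Prelude/FourManM/GaussDiagrams.lean @ 39b317f (interim HEAD d8f2665); M5 mechanical rewrite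
/-!
# Gauss diagrams, Polyak moves and their realisation by knots (trunk T-4MAN, outline C12)

This prelude file of the H21 library (trunk `FourManM`; notion `knot_diagram_realisation`,
knots only) provides the combinatorial layer of knot diagrams and its bridge to smooth knots
`Literature.Topology.FourManifolds.Knot` (`Literature.Prelude.FourManM.Knots`):

* `Literature.Topology.FourManifolds.GaussDiagram`: signed, based Gauss diagrams (`n` chords on `2n` cyclically ordered
  points, each chord oriented from over-passage to under-passage, with a sign in `ℤˣ`);
  `GaussDiagram.empty`, `writhe`, `mirror`, `reverse`, `rotate`, `relabel`, `IsRelabelling`,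
  and the bookkeeping operations `insertChord`, `braidMove`, `mapPos`;
* `Literature.Topology.FourManifolds.GaussDiagram.PolyakMove`: the oriented Reidemeister moves
  `Ω1a–Ω1d` (all first moves), `Ω2a, Ω2b` (co-oriented second moves) and `Ω3b` (the positive
  braid-like third move) of Polyak (2010) written on Gauss diagrams — all first moves and the
  *braid-like* second and third moves — and `GaussDiagram.Equiv`, the equivalence relation they
  generate (*Polyak equivalence*; see the correction note below); the companion module
  `GaussDiagramsRMoves` adds the anti-parallel second moves `Ω2c, Ω2d` (`GaussDiagram.RMove`),
  which makes the move set generating (Polyak (2010), Thm. 1.2), and `GaussDiagram.REquiv`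
  there is the equivalence relation it generates (Reidemeister equivalence of, possibly
  virtual, Gauss diagrams);
* realisation: the stereographic `Literature.planarProjection : 𝕊 3 → ℝ × ℝ` and `Literature.Topology.FourManifolds.height`, the
  structure `Literature.Knot.RegularProjection K` (a regular projection of the knot `K` together with
  the reading of its Gauss diagram) and the predicate `Literature.Knot.HasGaussDiagram K G`;
* named facts (`def … : Prop`, known in print; D-0014): existence of generic projections
  (`Knot.exists_hasGaussDiagram_of_isIsotopic`), the unknot has the empty diagram
  (`unknot_hasGaussDiagram_empty`, `hasGaussDiagram_unknot_empty`), behaviour under mirror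
  image and reversal;
* a registered OPEN statement, not a named fact: `Knot.reidemeister` ("Reidemeister's theorem"
  for `GaussDiagram.Equiv`; verdict clean-up 2026-08-17, see the note below and its docstring;
  the corrected statement, Reidemeister's theorem for `GaussDiagram.REquiv`, is recorded in
  that docstring and in `GaussDiagramsRMoves` and is to be vendored there as the named fact
  `Knot.isIsotopic_iff_rEquiv` by a fact-vending seat).

**Correction note (verdict clean-up 2026-08-17).** `PolyakMove` was written (2026-08) to
contain Polyak's minimal generating set `{Ω1a, Ω1b, Ω2a, Ω3a}` (Polyak (2010), Thm. 1.1) and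
`Knot.reidemeister` was vendored as Reidemeister's theorem for `Equiv`. But the constructor
`PolyakMove.omega3a` (three positive crossings, braid pattern `σ₁σ₂σ₁ → σ₂σ₁σ₂`) is Polyak's
move `Ω3b` ("the only `Ω3` move with all three positive crossings", Polyak (2010), §1,
footnote 2), not his cyclic generator `Ω3a`; the move set of `PolyakMove` is therefore
`{Ω1a, Ω1b, Ω1c, Ω1d, Ω2a, Ω2b, Ω3b}`, which contains no known generating set: with at most two
first moves `{Ω2a, Ω2b, Ω3b}` never generates (Polyak (2010), Thm. 1.2 and Lemma 3.8), and with
all four first moves generation is the open question of Audoux–Fiedler (2005), §1. The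
definitions `PolyakMove`/`Equiv` are kept unchanged (more than twenty files use the
constructors, several — parity projection, invariance of Khovanov homology and of Rasmussen's
invariant — by exhaustive case analysis), their docstrings corrected; `Knot.reidemeister` is
kept, name and body unchanged, as a registered open statement because seventeen files take it
as a hypothesis; no declaration is added here (the generating enlargement
`GaussDiagram.RMove`/`GaussDiagram.REquiv` lives in `GaussDiagramsRMoves`, which first recorded
the discrepancy).

No named-knot data live here (the Conway knot datum belongs to `Statements/SPC4/Piccirillo`).

## Sources

* K. Reidemeister, *Elementare Begründung der Knotentheorie*, Abh. Math. Sem. Univ. Hamburg 5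
  (1927) 24–32; *Knotentheorie* (1932), Kap. I.
* M. Polyak, *Minimal generating sets of Reidemeister moves*, Quantum Topol. 1 (2010) 399–411
  (arXiv:0908.3127): §1 (the oriented moves `Ω1a–d, Ω2a–d, Ω3a–h`; footnote 2: `Ω3b` is the
  only third move with three positive crossings), Thm. 1.1 (`{Ω1a, Ω1b, Ω2a, Ω3a}` generates),
  Thm. 1.2 (`{Ω1a, Ω1b, Ω2c, Ω2d, Ω3b}` generates; with `Ω3b` the moves `Ω2c, Ω2d` are needed),
  Lemma 3.1, Lemma 3.8.
* B. Audoux, T. Fiedler, *A Jones polynomial for braid-like isotopies of oriented links and its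
  categorification*, Algebr. Geom. Topol. 5 (2005) 1535–1553: Def. 1.1 (braid-like moves),
  Lemma 1.3, and the Question of §1 (do braid-like moves and the four first moves generate all
  isotopies? — open; not settled by Abel, Algebr. Geom. Topol. 17 (2017), §4.3, nor by
  Ito–Iwamoto, arXiv:2511.19918 (2025), whose non-generation results assume two first moves).
* M. Goussarov, M. Polyak, O. Viro, *Finite-type invariants of classical and virtual knots*,
  Topology 39 (2000) 1045–1068, §1 (Gauss diagrams, Reidemeister moves on them; §1.5,
  Thm. 1.B: virtually isotopic classical knots are isotopic).
* M. Polyak, O. Viro, *Gauss diagram formulas for Vassiliev invariants*, IMRN 1994:11.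
* D. Rolfsen, *Knots and Links* (1976), §3.E (regular projections), §3.C (mirror, reverse).
* L. Kauffman, *On Knots* (1987), Ch. II (writhe).
* Mathlib: nothing on knot diagrams, Gauss codes or Reidemeister moves (searched `Gauss`,
  `Reidemeister` — only a remark in `Mathlib.Algebra.Quandle`, `chord`); we use `Fin.succAbove`,
  `Fin.lastCases`, `finRotate`, `Fin.revPerm`, `Equiv.swap`, `Relation.EqvGen`, `SignType.sign`,
  `Matrix.det`, `deriv`. Mathlib's `stereographic` (`Geometry.Manifold.Instances.Sphere`) has
  an abstract codomain `(ℝ ∙ v)ᗮ`; explicit coordinates are used instead.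

## Design choices

* (Outline C12, Design 2.) Diagrams are Gauss diagrams à la Polyak–Viro rather than planar
  PD codes: a chord records the two passages through a crossing (over-end `overPos`, under-end
  `underPos`, both in `Fin (2 * n)`, jointly bijective) and its sign in `ℤˣ` (Mathlib's sign
  type as for `Equiv.Perm.sign`; no junk value `0`). `over` is a reserved token, hence the
  field names.
* Moves are stated *functorially*: each constructor of `PolyakMove` relates `G` to an
  explicitly computed diagram (`insertChord`, `braidMove`) under explicit adjacency hypotheses
  in index arithmetic; new chords are appended last and adjacency is `q, q + 1` in `ℕ`, the
  general case being recovered through the bookkeeping constructor `relabel` (chord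
  renumbering and rotation of the base point). Only creation of kinks/bigons and one direction
  of `Ω3a` are constructors; `GaussDiagram.Equiv := Relation.EqvGen PolyakMove` adds inverses.
* Sign/orientation conventions are fixed once: positions increase along the knot; a crossing
  is positive iff `(γ'(over), γ'(under))` is a positive basis of the oriented plane
  (right-handed); the viewer sits at height `+∞`. With these, `omega1a`/`omega1b` are the first
  moves entered along the over-strand, respectively the under-strand (each with both signs,
  i.e. all four oriented `Ω1` moves — a harmless superset of Polyak's pair `{Ω1a, Ω1b}`, chosen
  so that no left/right picture convention enters the definition), `omega2a` is the
  co-oriented second move (both strands meet the new crossings in the same order; Polyak's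
  `Ω2a`, and `Ω2b` by symmetry of the sign parameter) and `omega3a` the positive braid-like
  third move `σ₁σ₂σ₁ → σ₂σ₁σ₂` — Polyak's `Ω3b`, despite the constructor's name (see the
  correction note above); the anti-parallel second move (the strands meet the new crossings
  in opposite orders; Polyak's `Ω2c`, `Ω2d`) is `GaussDiagram.RMove.omega2c` in
  `GaussDiagramsRMoves`.
  All constructors are genuine oriented Reidemeister moves of Gauss diagrams; those of
  `GaussDiagram.RMove` contain the generating set `{Ω1a, Ω1b, Ω2c, Ω2d, Ω3b}` (Polyak (2010),
  Thm. 1.2), so `GaussDiagram.REquiv` is Reidemeister equivalence (through virtual diagrams,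
  which is legitimate by GPV Thm. 1.B), whereas `Equiv` (no `Ω2c, Ω2d`) is only known to
  imply it.
* Realisation uses the fixed stereographic projection from the north pole `(0, 0, 0, 1)`;
  `Knot.HasGaussDiagram K G` is an honest predicate (`∃ P : K.RegularProjection,
  P.diagram = G`), *not* invariant under isotopy of `K` — statements about knot types quantify
  over isotopic representatives (`Knot.exists_hasGaussDiagram_of_isIsotopic`,
  `Knot.HasGaussDiagram.mirror`).
* `rotate` takes `k : ℕ` (not `Fin (2 * n)`, which is empty for the empty diagram) and
  `RegularProjection.lt_add_two_pi` is stated for all pairs `i j` (no `θ 0` needed when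
  `n = 0`).
* Notation `𝔼 n`, `𝕊 n` is local, exactly as in the SPC4 statement files and `Knots`.
-/

open scoped Manifold ContDiff Topology
open Function Set

noncomputable section

namespace Literature.Topology.FourManifolds

/-- Local notation: `𝔼 n` is the model Euclidean space `EuclideanSpace ℝ (Fin n)`. -/
local notation "𝔼 " n:arg => EuclideanSpace ℝ (Fin n)

/-- Local notation: `𝕊 n` is the unit sphere in `EuclideanSpace ℝ (Fin (n + 1))`, the standard
`n`-sphere with its Mathlib manifold structure. -/
local notation "𝕊 " n:arg => (Metric.sphere (0 : EuclideanSpace ℝ (Fin (n + 1))) 1)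

/-! ## Gauss diagrams -/

/-- A (signed, based) **Gauss diagram** of a knot with `n` crossings: the circle carries `2 * n`
marked points, labelled `0, 1, …, 2n - 1` in the direction of the orientation of the knot
(position `0` is a base point), and `n` chords (arrows); chord `i` joins the position
`overPos i` at which the knot passes *over* crossing `i` to the position `underPos i` at which
it passes *under* it (the arrow of Goussarov–Polyak–Viro points from `overPos i` to
`underPos i`), and carries the sign `sign i ∈ ℤˣ = {1, -1}` of the crossing (local writhe;
Mathlib's sign type as in `Equiv.Perm.sign`, no junk value). Every marked point is the end of
exactly one chord (`bijective`).
M. Polyak, O. Viro, *Gauss diagram formulas for Vassiliev invariants*, IMRN 1994, §1;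
M. Goussarov, M. Polyak, O. Viro, *Finite-type invariants of classical and virtual knots*,
Topology 39 (2000), §1.2. [cite: IMRN1994, §1] -/
structure GaussDiagram where
  /-- The number of chords (crossings). -/
  n : ℕ
  /-- The position on the circle of the over-passage of crossing `i` (tail of arrow `i`). -/
  overPos : Fin n → Fin (2 * n)
  /-- The position on the circle of the under-passage of crossing `i` (head of arrow `i`). -/
  underPos : Fin n → Fin (2 * n)
  /-- The sign (local writhe) `±1` of crossing `i`. -/
  sign : Fin n → ℤˣ
  /-- Every one of the `2 * n` marked points is an endpoint of exactly one chord. -/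
  bijective : Bijective (Sum.elim overPos underPos)

namespace GaussDiagram

/-- The **empty Gauss diagram** (no chords): the Gauss diagram of the round unknot diagram.
GPV (2000), §1.2. [cite: GPV2000] -/
protected def empty : GaussDiagram where
  n := 0
  overPos := Fin.elim0
  underPos := Fin.elim0
  sign := Fin.elim0
  bijective := ⟨fun a ↦ by rcases a with a | a <;> exact a.elim0, fun b ↦ b.elim0⟩

/-- The empty diagram is the default Gauss diagram. [folklore] -/
instance : Inhabited GaussDiagram := ⟨GaussDiagram.empty⟩

/-- The **writhe** of a Gauss diagram: the sum of the signs of its chords.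
L. Kauffman, *On Knots* (1987), Ch. II; GPV (2000), §1.2. [cite: GPV2000] -/
def writhe (G : GaussDiagram) : ℤ :=
  ∑ i, (G.sign i : ℤ)

/-- The writhe of the empty diagram is `0`. [folklore] -/
@[simp]
theorem writhe_empty : GaussDiagram.empty.writhe = 0 := by
  simp [writhe, GaussDiagram.empty]

/-- Build a Gauss diagram with `n` chords from an equivalence `Fin n ⊕ Fin n ≃ Fin (2 * n)`
(left summand: over-passages, right summand: under-passages) and signs. [folklore] -/
def ofEquiv (n : ℕ) (e : Fin n ⊕ Fin n ≃ Fin (2 * n)) (sign : Fin n → ℤˣ) : GaussDiagram where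
  n := n
  overPos := e ∘ Sum.inl
  underPos := e ∘ Sum.inr
  sign := sign
  bijective := by
    rw [← Sum.comp_elim, Sum.elim_inl_inr]
    exact e.bijective

/-- The bijection "chord ends → positions" of a Gauss diagram, as an equivalence
`Fin n ⊕ Fin n ≃ Fin (2 * n)` (left summand: over-passages, right summand: under-passages). [folklore] -/
def endEquiv (G : GaussDiagram) : Fin G.n ⊕ Fin G.n ≃ Fin (2 * G.n) :=
  Equiv.ofBijective _ G.bijective

/-- On the left summand `endEquiv` is `overPos`. [folklore] -/
@[simp]
theorem endEquiv_inl (G : GaussDiagram) (i : Fin G.n) : G.endEquiv (Sum.inl i) = G.overPos i :=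
  rfl

/-- On the right summand `endEquiv` is `underPos`. [folklore] -/
@[simp]
theorem endEquiv_inr (G : GaussDiagram) (i : Fin G.n) : G.endEquiv (Sum.inr i) = G.underPos i :=
  rfl

/-- Move the marked points of a Gauss diagram by a permutation `τ` of the `2 * n` positions,
keeping chords and signs: chord `i` now joins `τ (overPos i)` to `τ (underPos i)`.
(Bookkeeping helper for `rotate`, `reverse` and the move `Ω3a`.) [folklore] -/
def mapPos (G : GaussDiagram) (τ : Equiv.Perm (Fin (2 * G.n))) : GaussDiagram :=
  ofEquiv G.n (G.endEquiv.trans τ) G.sign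

/-- `mapPos` keeps the number of chords. [folklore] -/
@[simp] theorem mapPos_n (G : GaussDiagram) (τ : Equiv.Perm (Fin (2 * G.n))) :
    (G.mapPos τ).n = G.n := rfl

/-- `mapPos τ` moves over-passages by `τ`. [folklore] -/
@[simp] theorem mapPos_overPos (G : GaussDiagram) (τ : Equiv.Perm (Fin (2 * G.n)))
    (i : Fin G.n) : (G.mapPos τ).overPos i = τ (G.overPos i) := rfl

/-- `mapPos τ` moves under-passages by `τ`. [folklore] -/
@[simp] theorem mapPos_underPos (G : GaussDiagram) (τ : Equiv.Perm (Fin (2 * G.n)))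
    (i : Fin G.n) : (G.mapPos τ).underPos i = τ (G.underPos i) := rfl

/-- `mapPos` keeps the signs. [folklore] -/
@[simp] theorem mapPos_sign (G : GaussDiagram) (τ : Equiv.Perm (Fin (2 * G.n))) :
    (G.mapPos τ).sign = G.sign := rfl

/-- The **mirror image** of a Gauss diagram: every over-passage becomes an under-passage and
conversely (all arrows are reversed) and all signs are negated. This is the Gauss diagram of
the mirror image of a knot diagram (all crossings switched). GPV (2000), §1.4;
Rolfsen (1976), §3.C. [cite: GPV2000] -/
def mirror (G : GaussDiagram) : GaussDiagram where
  n := G.n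
  overPos := G.underPos
  underPos := G.overPos
  sign := -G.sign
  bijective := by
    have h : Sum.elim G.underPos G.overPos = Sum.elim G.overPos G.underPos ∘ Sum.swap := by
      ext x; cases x <;> rfl
    rw [h]
    exact G.bijective.comp (Equiv.sumComm _ _).bijective

/-- The **reverse** of a Gauss diagram: the orientation of the circle is reversed, position `q`
becoming position `2n - 1 - q` (`Fin.rev`); arrows and signs are unchanged (reversing the
orientation of a knot reverses both tangent vectors at a crossing, so keeps its sign).
GPV (2000), §1.4; Rolfsen (1976), §3.C. [cite: GPV2000] -/
def reverse (G : GaussDiagram) : GaussDiagram :=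
  G.mapPos Fin.revPerm

/-- **Rotation** of a Gauss diagram (change of base point): position `q` becomes position
`q + k (mod 2n)` (`finRotate` iterated `k` times). GPV (2000), §1.2 (based versus unbased
Gauss diagrams). [cite: GPV2000] -/
def rotate (G : GaussDiagram) (k : ℕ) : GaussDiagram :=
  G.mapPos ((finRotate (2 * G.n)) ^ k)

/-- **Relabelling** the chords of a Gauss diagram by a permutation `σ` of `Fin n`: chord `i` of
the new diagram is chord `σ i` of the old one. [folklore] -/
def relabel (G : GaussDiagram) (σ : Equiv.Perm (Fin G.n)) : GaussDiagram where
  n := G.n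
  overPos := G.overPos ∘ σ
  underPos := G.underPos ∘ σ
  sign := G.sign ∘ σ
  bijective := by
    rw [← Sum.elim_comp_map]
    exact G.bijective.comp (Sum.map_bijective.2 ⟨σ.bijective, σ.bijective⟩)

/-- Two (based, labelled) Gauss diagrams are **relabellings** of each other if they differ by a
renumbering of the chords and a rotation of the base point, i.e. they have the same underlying
unbased, unlabelled Gauss diagram. GPV (2000), §1.2. [cite: GPV2000] -/
def IsRelabelling (G G' : GaussDiagram) : Prop :=
  ∃ (σ : Equiv.Perm (Fin G.n)) (k : ℕ), G' = (G.relabel σ).rotate k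

/-- Signs are unchanged by reversal, so the writhe is unchanged. [folklore] -/
@[simp]
theorem writhe_reverse (G : GaussDiagram) : G.reverse.writhe = G.writhe := rfl

/-- Signs are unchanged by rotation, so the writhe is unchanged. [folklore] -/
@[simp]
theorem writhe_rotate (G : GaussDiagram) (k : ℕ) : (G.rotate k).writhe = G.writhe := rfl

/-- The writhe of the mirror image is the negative of the writhe. Kauffman (1987), Ch. II. [cite: Kauffman1987] -/
@[simp]
theorem writhe_mirror (G : GaussDiagram) : G.mirror.writhe = -G.writhe := by
  change ∑ i : Fin G.n, ((-G.sign i : ℤˣ) : ℤ) = -∑ i : Fin G.n, (G.sign i : ℤ)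
  simp [Finset.sum_neg_distrib]

/-- Relabelling the chords does not change the writhe. [folklore] -/
@[simp]
theorem writhe_relabel (G : GaussDiagram) (σ : Equiv.Perm (Fin G.n)) :
    (G.relabel σ).writhe = G.writhe :=
  Equiv.sum_comp σ (fun i ↦ (G.sign i : ℤ))

/-! ### Inserting a chord; the braid rearrangement -/

/-- **Insert one chord** into a Gauss diagram `G` with `n` chords. The new diagram has `n + 1`
chords and `2n + 2` marked points; the new chord has index `Fin.last n` and sign `ε`, its
over-passage is the new position `o : Fin (2n + 2)` and its under-passage the new position
`o.succAbove u` (so `(o, u)` ranges exactly once over the ordered pairs of distinct new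
positions); the old marked point `q` becomes `o.succAbove (u.succAbove q)`, i.e. the old points
keep their cyclic order and fill the remaining `2n` positions increasingly. Old chords keep
their indices (`Fin.castSucc`), endpoints and signs. In particular (`Fin.succAbove`):
* `o = p.castSucc, u = p` for `p : Fin (2n + 1)` puts the new chord at the adjacent positions
  `p` (over) and `p + 1` (under) — an isolated arrow whose tail comes first;
* `o = p.succ, u = p` puts it at positions `p` (under) and `p + 1` (over) — head first.
This is the combinatorial operation underlying the Reidemeister moves `Ω1` and `Ω2` on Gauss
diagrams (Polyak 2010, §2; GPV (2000), Fig. 3). [cite: Polyak2010, §2] -/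
def insertChord (G : GaussDiagram) (o : Fin (2 * G.n + 2)) (u : Fin (2 * G.n + 1)) (ε : ℤˣ) :
    GaussDiagram where
  n := G.n + 1
  overPos := Fin.lastCases o fun i ↦ o.succAbove (u.succAbove (G.overPos i))
  underPos := Fin.lastCases (o.succAbove u) fun i ↦ o.succAbove (u.succAbove (G.underPos i))
  sign := Fin.lastCases ε G.sign
  bijective := by
    classical
    refine (Fintype.bijective_iff_injective_and_card _).2 ⟨?_, by simp; omega⟩
    have hG := G.bijective.injective
    have h1 : Injective G.overPos := fun i j h ↦
      Sum.inl_injective (hG (a₁ := .inl i) (a₂ := .inl j) h)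
    have h2 : Injective G.underPos := fun i j h ↦
      Sum.inr_injective (hG (a₁ := .inr i) (a₂ := .inr j) h)
    have h3 : ∀ i j, G.overPos i ≠ G.underPos j := fun i j h ↦
      Sum.inl_ne_inr (hG (a₁ := .inl i) (a₂ := .inr j) h)
    have h4 : ∀ i j, G.underPos i ≠ G.overPos j := fun i j h ↦ (h3 j i) h.symm
    rintro (i | i) (j | j) h <;> induction i using Fin.lastCases <;>
      induction j using Fin.lastCases <;>
      simp_all [Fin.succAbove_ne, Fin.ne_succAbove, h1.eq_iff, h2.eq_iff]

/-- `insertChord` adds one chord. [folklore] -/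
@[simp] theorem insertChord_n (G : GaussDiagram) (o : Fin (2 * G.n + 2)) (u : Fin (2 * G.n + 1))
    (ε : ℤˣ) : (G.insertChord o u ε).n = G.n + 1 := rfl

/-- The over-passage of the inserted chord is `o`. [folklore] -/
@[simp] theorem insertChord_overPos_last (G : GaussDiagram) (o : Fin (2 * G.n + 2))
    (u : Fin (2 * G.n + 1)) (ε : ℤˣ) : (G.insertChord o u ε).overPos (Fin.last G.n) = o := by
  simp [insertChord]

/-- The under-passage of the inserted chord is `o.succAbove u`. [folklore] -/
@[simp] theorem insertChord_underPos_last (G : GaussDiagram) (o : Fin (2 * G.n + 2))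
    (u : Fin (2 * G.n + 1)) (ε : ℤˣ) :
    (G.insertChord o u ε).underPos (Fin.last G.n) = o.succAbove u := by
  simp [insertChord]

/-- The sign of the inserted chord is `ε`. [folklore] -/
@[simp] theorem insertChord_sign_last (G : GaussDiagram) (o : Fin (2 * G.n + 2))
    (u : Fin (2 * G.n + 1)) (ε : ℤˣ) : (G.insertChord o u ε).sign (Fin.last G.n) = ε := by
  simp [insertChord]

/-- Old chords keep their over-passages, renumbered by the double `Fin.succAbove`. [folklore] -/
@[simp] theorem insertChord_overPos_castSucc (G : GaussDiagram) (o : Fin (2 * G.n + 2))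
    (u : Fin (2 * G.n + 1)) (ε : ℤˣ) (i : Fin G.n) :
    (G.insertChord o u ε).overPos i.castSucc = o.succAbove (u.succAbove (G.overPos i)) := by
  simp [insertChord]

/-- Old chords keep their under-passages, renumbered by the double `Fin.succAbove`. [folklore] -/
@[simp] theorem insertChord_underPos_castSucc (G : GaussDiagram) (o : Fin (2 * G.n + 2))
    (u : Fin (2 * G.n + 1)) (ε : ℤˣ) (i : Fin G.n) :
    (G.insertChord o u ε).underPos i.castSucc = o.succAbove (u.succAbove (G.underPos i)) := by
  simp [insertChord]

/-- Old chords keep their signs. [folklore] -/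
@[simp] theorem insertChord_sign_castSucc (G : GaussDiagram) (o : Fin (2 * G.n + 2))
    (u : Fin (2 * G.n + 1)) (ε : ℤˣ) (i : Fin G.n) :
    (G.insertChord o u ε).sign i.castSucc = G.sign i := by
  simp [insertChord]

/-- Inserting a chord changes the writhe by its sign. [folklore] -/
theorem writhe_insertChord (G : GaussDiagram) (o : Fin (2 * G.n + 2)) (u : Fin (2 * G.n + 1))
    (ε : ℤˣ) : (G.insertChord o u ε).writhe = G.writhe + ε := by
  change ∑ i : Fin (G.n + 1), ((Fin.lastCases ε G.sign i : ℤˣ) : ℤ) = _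
  rw [Fin.sum_univ_castSucc]
  simp [writhe]

/-- The **braid rearrangement** of three chords `x y z` of a Gauss diagram: the three
transpositions of positions `overPos x ↔ overPos y`, `underPos x ↔ overPos z`,
`underPos y ↔ underPos z` (applied to all endpoints), chords and signs being kept. When the
three swapped pairs are pairs of *adjacent* positions (and the signs are `+1`) this is the
braid-like third Reidemeister move `Ω3b` of Polyak (2010) on Gauss diagrams (see
`PolyakMove.omega3a`); in general it is mere bookkeeping used to state that move.
Polyak (2010), §1 (`Ω3b`); GPV (2000), Fig. 3. [cite: Polyak2010, §1] -/
def braidMove (G : GaussDiagram) (x y z : Fin G.n) : GaussDiagram :=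
  G.mapPos (Equiv.swap (G.overPos x) (G.overPos y) * Equiv.swap (G.underPos x) (G.overPos z) *
    Equiv.swap (G.underPos y) (G.underPos z))

/-- The braid rearrangement keeps the signs, hence the writhe. [folklore] -/
@[simp] theorem writhe_braidMove (G : GaussDiagram) (x y z : Fin G.n) :
    (G.braidMove x y z).writhe = G.writhe := rfl

/-! ### Polyak moves: the first moves and the braid-like second and third moves -/

/-- **Polyak moves** (the name is historical — see the correction at the end of this
docstring): the oriented Reidemeister moves `Ω1a, Ω1b, Ω1c, Ω1d` (all four first moves),
`Ω2a, Ω2b` (the two second moves with *co-oriented* strands) and `Ω3b` (the braid-like third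
move with three positive crossings) in the notation of M. Polyak, *Minimal generating sets of
Reidemeister moves*, Quantum Topol. 1 (2010) 399–411, §1, written on (based, labelled, signed)
Gauss diagrams as in Goussarov–Polyak–Viro (2000), §1 and Fig. 3, together with the
bookkeeping move `relabel` (renumbering chords, moving the base point). Only the *creating*
direction of `Ω1`, `Ω2` and one direction of `Ω3` are constructors; the symmetric closure
(`GaussDiagram.Equiv`) supplies the inverse moves. Positions are read in the direction of the
knot; "adjacent" means
consecutive natural numbers `q, q + 1` (a pair `2n - 1, 0` across the base point is reached
after a rotation, `relabel`). Conventions for pictures: the plane is oriented, a crossing is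
*positive* (`sign = 1`) iff `(tangent of over-strand, tangent of under-strand)` is a positive
basis (right-handed crossing), cf. `Knot.RegularProjection.sign_eq`.

* `omega1a` (first Reidemeister move, kink entered along the over-strand): insert an isolated
  arrow whose tail (over-passage) and head (under-passage) occupy adjacent positions `p, p + 1`
  in this order, with either sign `ε` (`ε = 1`: the kink lies to the right of the strand and
  is traversed clockwise; `ε = -1`: to the left, counterclockwise).
* `omega1b` (first Reidemeister move, kink entered along the under-strand): the same with head
  first, positions `p` (under), `p + 1` (over), either sign `ε` (`ε = 1`: kink to the left;
  `ε = -1`: kink to the right).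
  Polyak's four oriented first moves `Ω1a, Ω1b, Ω1c, Ω1d` (2010, §1) are exactly these four
  (order of passages × sign); a generating set needs a *compatible pair* of them (changing
  writhe and Whitney index independently, Polyak 2010, Lemma 3.1), so allowing both signs in
  each constructor frees the definition from left/right picture conventions.
* `omega2a` (second Reidemeister move with **co-oriented** strands, Polyak's `Ω2a`/`Ω2b` — the
  *braid-like* second moves): insert two arrows `x` (index `n`) and `y` (index `n + 1`) with
  opposite signs `ε, -ε` such that the tails are adjacent, tail of `x` immediately before tail
  of `y`, and the heads are adjacent, head of `x` immediately before head of `y` (both strands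
  meet `x` first: they point the same way; the over-strand bulges over the under-strand creating
  the bigon `x y`). The *anti-parallel* second moves `Ω2c`/`Ω2d` (heads met in the opposite
  order) are **not** constructors here; they are `GaussDiagram.RMove.omega2c` in the companion
  module `GaussDiagramsRMoves`.
* `omega3a` (third Reidemeister move, **positive braid-like**: `σ₁σ₂σ₁ → σ₂σ₁σ₂` with all three
  strands co-oriented and all three crossings positive — this is the move **`Ω3b`** of Polyak
  (2010) ("the only `Ω3` move with all three positive crossings", §1, footnote 2), *not* his
  `Ω3a`, which is the *cyclic* third move; the constructor keeps its original name, used by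
  more than twenty files): three chords `x y z` of sign `+1`; the top strand `a` passes over
  `x` then over `y` at adjacent positions, the middle strand `b` passes under `x` then over `z`
  at adjacent positions, the bottom strand `c` passes under `y` then under `z` at adjacent
  positions; the move reverses the order of the two passages on each of the three strands
  (`braidMove`), keeping signs. (Check: in the braid `σ₁σ₂σ₁` with co-oriented strands and the
  right-moving strand on top, the strand `a` starting left is over at crossings `1, 2`, `b`
  starting in the middle is under at `1` and over at `3`, `c` is under at `2, 3`, all three
  crossings are right-handed, and `σ₂σ₁σ₂` reverses the order on each strand.)

**Correction (verdict clean-up 2026-08-17).** The move set of `PolyakMove` is thus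
`{Ω1a, Ω1b, Ω1c, Ω1d, Ω2a, Ω2b, Ω3b}` — all first moves and the braid-like second and third
moves (the other braid-like third moves are composites of `Ω3b` and `Ω2a, Ω2b`, Audoux–Fiedler
(2005), Lemma 1.3) — and not, as intended and as earlier docstrings said, a superset of
Polyak's minimal generating set `{Ω1a, Ω1b, Ω2a, Ω3a}` (Thm. 1.1). It is not known to generate
all oriented Reidemeister moves: a set of at most five moves whose only third move is `Ω3b`
generates iff it contains the anti-parallel moves `Ω2c, Ω2d` and a compatible pair of first
moves (Polyak (2010), Thm. 1.2), `{Ω2a, Ω2b, Ω3b}` with two first moves never generates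
(Lemma 3.8), and with all four first moves the question is open: Audoux–Fiedler (2005), §1,
"do braid-like isotopies and Markov moves (i.e. the four types of Reidemeister I moves in the
plane) generate isotopies of oriented links in 3-space?". Hence `GaussDiagram.Equiv` below is
*Polyak equivalence*, which implies Reidemeister equivalence `GaussDiagram.REquiv` of the
companion module `GaussDiagramsRMoves` (generated by `GaussDiagram.RMove` = `PolyakMove` + the
anti-parallel `Ω2c/Ω2d`, a generating set by Thm. 1.2) and is not known to coincide with it,
even on diagrams of knots (`Knot.reidemeister`). Every constructor is a genuine oriented
Reidemeister move of Gauss diagrams applied regardless of planarity (GPV (2000), §1, virtual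
isotopy). [cite: Polyak2010, §1 and Thm. 1.2] -/
inductive PolyakMove : GaussDiagram → GaussDiagram → Prop
  /-- Bookkeeping: renumber the chords and move the base point (`IsRelabelling`). -/
  | relabel (G G' : GaussDiagram) (h : G.IsRelabelling G') : PolyakMove G G'
  /-- `Ω1`, over-passage first: an isolated arrow at adjacent positions `p` (tail), `p + 1`
  (head), any sign. Polyak (2010), §1, `Ω1a–d`; GPV (2000), Fig. 3, first move. -/
  | omega1a (G : GaussDiagram) (p : Fin (2 * G.n + 1)) (ε : ℤˣ) :
      PolyakMove G (G.insertChord p.castSucc p ε)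
  /-- `Ω1`, under-passage first: an isolated arrow at adjacent positions `p` (head), `p + 1`
  (tail), any sign. Polyak (2010), §1, `Ω1a–d`; GPV (2000), Fig. 3, first move. -/
  | omega1b (G : GaussDiagram) (p : Fin (2 * G.n + 1)) (ε : ℤˣ) :
      PolyakMove G (G.insertChord p.succ p ε)
  /-- `Ω2a`/`Ω2b` (co-oriented = braid-like second move): two new arrows `x = Fin.last n`
  (inserted first, sign `ε`) and `y = Fin.last (n + 1)` (sign `-ε`) with
  `overPos y = overPos x + 1` and `underPos y = underPos x + 1`. Polyak (2010), §1, `Ω2a, Ω2b`;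
  GPV (2000), Fig. 3, second move. -/
  | omega2a (G : GaussDiagram) (o : Fin (2 * G.n + 2)) (u : Fin (2 * G.n + 1))
      (o' : Fin (2 * (G.n + 1) + 2)) (u' : Fin (2 * (G.n + 1) + 1)) (ε : ℤˣ)
      (hover : (((G.insertChord o u ε).insertChord o' u' (-ε)).overPos (Fin.last (G.n + 1)) : ℕ)
        = ((G.insertChord o u ε).insertChord o' u' (-ε)).overPos (Fin.last G.n).castSucc + 1)
      (hunder : (((G.insertChord o u ε).insertChord o' u' (-ε)).underPos (Fin.last (G.n + 1)) : ℕ)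
        = ((G.insertChord o u ε).insertChord o' u' (-ε)).underPos (Fin.last G.n).castSucc + 1) :
      PolyakMove G ((G.insertChord o u ε).insertChord o' u' (-ε))
  /-- Polyak's `Ω3b` (positive braid-like third move `σ₁σ₂σ₁ → σ₂σ₁σ₂`; the constructor's
  name `omega3a` is a historical misnomer, see the docstring of `PolyakMove`): chords `x y z`
  of sign `+1` with `overPos y = overPos x + 1` (top strand), `overPos z = underPos x + 1`
  (middle strand), `underPos z = underPos y + 1` (bottom strand); the orders on the three
  strands are reversed. Polyak (2010), §1, `Ω3b` (footnote 2); GPV (2000), Fig. 3, third move. -/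
  | omega3a (G : GaussDiagram) (x y z : Fin G.n) (hx : G.sign x = 1) (hy : G.sign y = 1)
      (hz : G.sign z = 1) (ha : (G.overPos y : ℕ) = G.overPos x + 1)
      (hb : (G.overPos z : ℕ) = G.underPos x + 1) (hc : (G.underPos z : ℕ) = G.underPos y + 1) :
      PolyakMove G (G.braidMove x y z)

/-- **Polyak equivalence** of Gauss diagrams: the equivalence relation generated by the Polyak
moves (`Relation.EqvGen`; the symmetric closure provides removal of kinks and bigons and the
inverse braid move), i.e. by all first moves and the braid-like second and third moves
`Ω1a–d, Ω2a, Ω2b, Ω3b`, applied regardless of realisability ("braid-like isotopy together with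
the four first moves" of Audoux–Fiedler (2005), Def. 1.1 and §1, on Gauss diagrams). It
implies Reidemeister equivalence `GaussDiagram.REquiv` of the companion module
`GaussDiagramsRMoves` (generated by `GaussDiagram.RMove` = these moves and the anti-parallel
second moves `Ω2c, Ω2d`, a generating set by Polyak (2010), Thm. 1.2; the implication is
`GaussDiagram.Equiv.rEquiv` there); whether the two coincide — even on Gauss diagrams of knots —
is the open question of Audoux–Fiedler (2005), §1 (see `PolyakMove` and the open statement
`Knot.reidemeister`). Docstrings of 2026-08 calling this relation "Reidemeister equivalence"
predate the correction of 2026-08-17; the invariance results proved constructor by constructor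
for `PolyakMove` elsewhere in this directory are results about this relation.
[cite: AudouxFiedler2005, Def. 1.1 and §1] -/
protected def Equiv : GaussDiagram → GaussDiagram → Prop :=
  Relation.EqvGen PolyakMove

/-- Polyak equivalence of Gauss diagrams is an equivalence relation. [folklore] -/
theorem equivalence_equiv : Equivalence GaussDiagram.Equiv :=
  Relation.EqvGen.is_equivalence _

/-- Polyak equivalence is reflexive. [folklore] -/
protected theorem Equiv.refl (G : GaussDiagram) : G.Equiv G :=
  Relation.EqvGen.refl G

/-- Polyak equivalence is symmetric. [folklore] -/
protected theorem Equiv.symm {G G' : GaussDiagram} (h : G.Equiv G') : G'.Equiv G :=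
  Relation.EqvGen.symm _ _ h

/-- Polyak equivalence is transitive. [folklore] -/
protected theorem Equiv.trans {G G' G'' : GaussDiagram} (h : G.Equiv G') (h' : G'.Equiv G'') :
    G.Equiv G'' :=
  Relation.EqvGen.trans _ _ _ h h'

/-- A Polyak move is a Polyak equivalence. [folklore] -/
theorem PolyakMove.equiv {G G' : GaussDiagram} (h : PolyakMove G G') : G.Equiv G' :=
  Relation.EqvGen.rel _ _ h

/-- A Gauss diagram is equivalent to each of its rotations (change of base point). [folklore] -/
theorem equiv_rotate (G : GaussDiagram) (k : ℕ) : G.Equiv (G.rotate k) :=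
  (PolyakMove.relabel G _ ⟨1, k, by cases G; rfl⟩).equiv

end GaussDiagram

/-! ## Realisation: regular projections of smooth knots -/

/-- The **north pole** `(0, 0, 0, 1)` of `𝕊 3`, the centre of the stereographic projection
used to draw knot diagrams. [folklore] -/
def northPole : 𝕊 3 :=
  ⟨EuclideanSpace.single (3 : Fin 4) 1, by simp⟩

/-- Coordinates of the north pole. [folklore] -/
@[simp]
theorem coe_northPole : (northPole : 𝔼 4) = EuclideanSpace.single (3 : Fin 4) 1 := rfl

/-- The **planar projection** `𝕊 3 → ℝ²`: stereographic projection from the north pole,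
`x ↦ (1 - x₃)⁻¹ • (x₀, x₁, x₂) ∈ ℝ³`, followed by forgetting the last coordinate:
`x ↦ ((1 - x₃)⁻¹ x₀, (1 - x₃)⁻¹ x₁)`. (Mathlib's `stereographic` lands in the abstract
orthogonal complement `(ℝ ∙ v)ᗮ`; we use explicit coordinates.) Junk value `(0, 0)` at the
north pole (`(1 - 1)⁻¹ = 0`), never used. Rolfsen (1976), §3.E (regular projections). [cite: Rolfsen1976] -/
def planarProjection (x : 𝕊 3) : ℝ × ℝ :=
  ((1 - (x : 𝔼 4) 3)⁻¹ * (x : 𝔼 4) 0, (1 - (x : 𝔼 4) 3)⁻¹ * (x : 𝔼 4) 1)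

/-- The **height** `𝕊 3 → ℝ` over the projection plane: the third stereographic coordinate
`x ↦ (1 - x₃)⁻¹ x₂`. Together with `planarProjection` it is the stereographic diffeomorphism
`𝕊 3 ∖ {northPole} → ℝ² × ℝ`; the viewer looks down from `+∞` along this axis, so at a
crossing the strand with the larger height passes *over*. Junk value `0` at the north pole. [folklore] -/
def height (x : 𝕊 3) : ℝ :=
  (1 - (x : 𝔼 4) 3)⁻¹ * (x : 𝔼 4) 2

namespace Knot

/-- The **plane curve** of a knot: `t ↦ planarProjection (K (cos t, sin t))`, a `2π`-periodic
curve `ℝ → ℝ²` (smooth when `K` misses the north pole). Rolfsen (1976), §3.E. [cite: Rolfsen1976] -/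
def planeCurve (K : Knot) (t : ℝ) : ℝ × ℝ :=
  planarProjection (K (circlePoint t))

/-- The **height function** of a knot along its parametrisation: `t ↦ height (K (cos t, sin t))`.
[folklore] -/
def heightCurve (K : Knot) (t : ℝ) : ℝ :=
  height (K (circlePoint t))

/-- The plane curve of a knot is `2π`-periodic. [folklore] -/
theorem periodic_planeCurve (K : Knot) : Periodic K.planeCurve (2 * Real.pi) := fun t ↦ by
  simp [planeCurve, circlePoint_add_two_pi]

/-- The height function of a knot is `2π`-periodic. [folklore] -/
theorem periodic_heightCurve (K : Knot) : Periodic K.heightCurve (2 * Real.pi) := fun t ↦ by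
  simp [heightCurve, circlePoint_add_two_pi]

/-- A **regular projection** of a knot `K` with a reading of its Gauss diagram. Data: a Gauss
diagram `diagram` with `n` chords and strictly increasing parameters
`θ₀ < θ₁ < ⋯ < θ₂ₙ₋₁ < θ₀ + 2π` of the `2n` passages through crossings, in the order met along
the knot `t ↦ K (cos t, sin t)`. Conditions (Rolfsen (1976), §3.E; Reidemeister,
*Knotentheorie* (1932), Kap. I, §1): `K` misses the north pole, so that the plane curve
`γ = K.planeCurve` (stereographic projection) is smooth; `γ` is an immersion
(`deriv_ne_zero`); positions `overPos i` and `underPos i` of the diagram are the two passages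
through the double point number `i` (`double`), and these are the only multiple points of
`γ` on a period (`eq_or_crossing`, which also excludes triple points thanks to `bijective`);
the over-passage is the one of larger height (`heightCurve_lt`); the crossing is transverse and
its sign is the sign of `det (γ' (over), γ' (under))` in the oriented plane (`sign_eq`,
right-handed crossings are positive; transversality `transverse` follows since signs are
`±1`). [cite: Rolfsen1976] -/
structure RegularProjection (K : Knot) where
  /-- The Gauss diagram read off the projection. -/
  diagram : GaussDiagram
  /-- The parameters of the `2n` passages through crossings, position by position. -/
  θ : Fin (2 * diagram.n) → ℝ
  /-- The parameters increase with the position (positions are met in this order). -/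
  strictMono : StrictMono θ
  /-- All parameters lie in one period: `θ i < θ j + 2π` (i.e. `θ₂ₙ₋₁ < θ₀ + 2π`). -/
  lt_add_two_pi : ∀ i j, θ i < θ j + 2 * Real.pi
  /-- The knot misses the centre of projection. -/
  northPole_notMem : northPole ∉ range K
  /-- The plane curve is an immersion. -/
  deriv_ne_zero : ∀ t, deriv K.planeCurve t ≠ 0
  /-- The two passages of chord `i` project to the same point (a double point). -/
  double : ∀ i, K.planeCurve (θ (diagram.overPos i)) = K.planeCurve (θ (diagram.underPos i))
  /-- The double points listed are the only multiple points: if `γ s = γ t` then either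
  `s ≡ t (mod 2π)` or `{s, t}` is, modulo `2π`, the pair of passages of some crossing `i`. -/
  eq_or_crossing : ∀ s t, K.planeCurve s = K.planeCurve t →
    (∃ k : ℤ, t = s + k * (2 * Real.pi)) ∨
      ∃ (i : Fin diagram.n) (k l : ℤ), ({s + k * (2 * Real.pi), t + l * (2 * Real.pi)} : Set ℝ)
        = {θ (diagram.overPos i), θ (diagram.underPos i)}
  /-- At crossing `i` the passage `overPos i` is above the passage `underPos i`. -/
  heightCurve_lt : ∀ i,
    K.heightCurve (θ (diagram.underPos i)) < K.heightCurve (θ (diagram.overPos i))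
  /-- The sign of crossing `i` is the sign of `det (γ' over, γ' under)`: `+1` for a
  right-handed crossing, `-1` for a left-handed one (and the crossing is transverse). -/
  sign_eq : ∀ i, (diagram.sign i : ℤ) = SignType.sign (Matrix.det
    !![(deriv K.planeCurve (θ (diagram.overPos i))).1,
        (deriv K.planeCurve (θ (diagram.overPos i))).2;
       (deriv K.planeCurve (θ (diagram.underPos i))).1,
        (deriv K.planeCurve (θ (diagram.underPos i))).2])

namespace RegularProjection

variable {K : Knot} (P : K.RegularProjection)

/-- In a regular projection every crossing is transverse: the determinant of the two tangent
vectors is non-zero (its sign is the sign `±1` of the crossing). [folklore] -/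
theorem det_ne_zero (i : Fin P.diagram.n) : Matrix.det
    !![(deriv K.planeCurve (P.θ (P.diagram.overPos i))).1,
        (deriv K.planeCurve (P.θ (P.diagram.overPos i))).2;
       (deriv K.planeCurve (P.θ (P.diagram.underPos i))).1,
        (deriv K.planeCurve (P.θ (P.diagram.underPos i))).2] ≠ 0 := by
  intro h
  have := P.sign_eq i
  rw [h, sign_zero] at this
  exact (P.diagram.sign i).ne_zero (by exact_mod_cast this)

/-- In a regular projection every crossing is transverse: the two tangent vectors are linearly
independent. Rolfsen (1976), §3.E. [cite: Rolfsen1976] -/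
theorem transverse (i : Fin P.diagram.n) : LinearIndependent ℝ
    ![deriv K.planeCurve (P.θ (P.diagram.overPos i)),
      deriv K.planeCurve (P.θ (P.diagram.underPos i))] := by
  have hd := P.det_ne_zero i
  rw [Matrix.det_fin_two_of] at hd
  generalize deriv K.planeCurve (P.θ (P.diagram.overPos i)) = v at hd ⊢
  generalize deriv K.planeCurve (P.θ (P.diagram.underPos i)) = w at hd ⊢
  rw [LinearIndependent.pair_iff]
  intro s t hst
  simp only [Prod.ext_iff, Prod.smul_fst, Prod.smul_snd, Prod.fst_add, Prod.snd_add,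
    smul_eq_mul, Prod.fst_zero, Prod.snd_zero] at hst
  obtain ⟨h1, h2⟩ := hst
  constructor
  · have hs : s * (v.1 * w.2 - v.2 * w.1) = 0 := by linear_combination w.2 * h1 - w.1 * h2
    exact (mul_eq_zero.1 hs).resolve_right hd
  · have ht : t * (v.1 * w.2 - v.2 * w.1) = 0 := by linear_combination v.1 * h2 - v.2 * h1
    exact (mul_eq_zero.1 ht).resolve_right hd

/-- The parameters of a regular projection are injective. [folklore] -/
theorem injective_θ : Injective P.θ :=
  P.strictMono.injective

end RegularProjection

/-- A knot `K` **has Gauss diagram** `G` if some regular projection of `K` (stereographic, from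
the north pole, with some choice of base point and numbering of the crossings) reads `G`.
GPV (2000), §1.2; Rolfsen (1976), §3.E. [cite: GPV2000] -/
def HasGaussDiagram (K : Knot) (G : GaussDiagram) : Prop :=
  ∃ P : K.RegularProjection, P.diagram = G

/-- **Generic projections exist**: every knot is isotopic to a knot in regular position with
respect to the stereographic projection, which therefore has a Gauss diagram (a small isotopy
makes the projection an immersion with transverse double points only, missing the north
pole). Reidemeister (1932), Kap. I, §1; Rolfsen (1976), §3.E; via transversality:
Guillemin–Pollack (1974), Ch. 2, §3. [cite: Reidemeister1932] -/
def exists_hasGaussDiagram_of_isIsotopic : Prop :=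
  ∀ K : Knot, ∃ (K' : Knot) (G : GaussDiagram), K.IsIsotopic K' ∧ K'.HasGaussDiagram G

/-- OPEN CONJECTURE — **not a theorem as stated; kept, body unchanged, because seventeen
files take it as the hypothesis `(hR : Knot.reidemeister)`** (verdict clean-up 2026-08-17),
posed — in its planar form, for links — as the Question of Audoux–Fiedler (2005), §1
[status: open]: if the knots `K, K'` have Gauss diagrams `G, G'`, then `K` and `K'` are
(ambient) isotopic iff `G` and `G'` are *Polyak equivalent* (`GaussDiagram.Equiv`: related,
through arbitrary Gauss diagrams, by the first moves and the braid-like second and third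
moves `Ω1a–d, Ω2a, Ω2b, Ω3b` and their inverses).
**What is wrong.** The statement was vendored (2026-08) as "Reidemeister's theorem, Gauss
diagram form", citing Reidemeister (1927), Polyak (2010), Thm. 1.1 (the moves
`Ω1a, Ω1b, Ω2a, Ω3a` generate) and GPV (2000), Thm. 1.B. But the third move of `PolyakMove` is
Polyak's `Ω3b`, not `Ω3a` (see `PolyakMove`), so Thm. 1.1 does not apply, and
`{Ω1a–d, Ω2a, Ω2b, Ω3b}` contains no known generating set: with at most two first moves
`{Ω2a, Ω2b, Ω3b}` does not generate (Polyak (2010), Thm. 1.2, Lemma 3.8), and whether it does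
with all four first moves is the open question of Audoux–Fiedler (2005), §1 ("Is the natural
analogue of Markov's theorem still true, i.e. do braid-like isotopies and Markov moves (i.e.
the four types of Reidemeister I moves in the plane) generate isotopies of oriented links in
3-space?"), unsettled as of Abel (2017), §4.3 and Ito–Iwamoto (2025). Precisely: the
direction `←` does hold under the corrected statement (Polyak equivalence implies
Reidemeister equivalence, `GaussDiagram.Equiv.rEquiv` in `GaussDiagramsRMoves`); the direction
`→` ("isotopic knots have Polyak-equivalent Gauss diagrams", virtual intermediate diagrams
allowed) would follow from a positive answer to that question and is otherwise unsupported —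
a breadth-first search by the proving seat (2026-08) found a 5-crossing diagram of the unknot
that is not `Equiv`-trivial through diagrams with at most 8 arrows (evidence that `→` may
fail; not a disproof). No `reidemeister_holds` can be attempted from the literature.
**The corrected statement** is Reidemeister's theorem for the generating move set
`GaussDiagram.RMove` / `GaussDiagram.REquiv` of `GaussDiagramsRMoves` (these moves and the
anti-parallel `Ω2c, Ω2d`, containing the generating set `{Ω1a, Ω1b, Ω2c, Ω2d, Ω3b}` of Polyak
(2010), Thm. 1.2):
`∀ {K K' : Knot} {G G' : GaussDiagram}, K.HasGaussDiagram G → K'.HasGaussDiagram G' → (K.IsIsotopic K' ↔ G.REquiv G')`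
(`→`: Reidemeister (1927) and Polyak (2010), Thm. 1.2, each of `Ω1a, Ω1b, Ω2c, Ω2d, Ω3b` being
an `RMove` up to `relabel`; `←`: GPV (2000), §1.5, Thm. 1.B, virtually isotopic classical
knots are isotopic). It is recorded in `GaussDiagramsRMoves` and is to be vendored there as
the named fact `Knot.isIsotopic_iff_rEquiv` by a fact-vending seat (a verdict clean-up seat
may not add named facts, D-0026). Consumers of `hR : Knot.reidemeister` use its direction `→`
followed by invariance under each `PolyakMove`; to migrate to the corrected statement they
additionally need invariance under the anti-parallel second move `GaussDiagram.RMove.omega2c`.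
(No `@[deprecated]` attribute: the consumers include gate-written route files, which must stay
warning-free; the name is kept for the same reason.) [cite: AudouxFiedler2005, §1 (Question)] -/
def reidemeister : Prop :=
  ∀ {K K' : Knot} {G G' : GaussDiagram}, K.HasGaussDiagram G → K'.HasGaussDiagram G' →
    (K.IsIsotopic K' ↔ G.Equiv G')

/-- Knots with a common Gauss diagram are isotopic (a realisable signed Gauss diagram
determines the knot type) — conditional on the OPEN statement `Knot.reidemeister` (hypothesis
`hR`), of which only the valid direction `←` is used (GPV (2000), Thm. 1.B: virtually isotopic
classical knots are isotopic). [cite: GPV2000, Thm. 1.B] -/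
theorem HasGaussDiagram.isIsotopic (hR : Knot.reidemeister) {K K' : Knot} {G : GaussDiagram}
    (h : K.HasGaussDiagram G) (h' : K'.HasGaussDiagram G) : K.IsIsotopic K' :=
  (hR h h').2 (GaussDiagram.Equiv.refl G)

/-- Reversing a knot reverses its Gauss diagrams: `K.reverse = K ∘ reflectLast 1` is
parametrised by `t ↦ K (cos t, -sin t) = K (circlePoint (-t))`, so the same projection with
parameters `-θ` read backwards realises `G.reverse`. GPV (2000), §1.4. (`Knot.reverse` consumes
the smoothness facts of `Knots`, `[SphereEmbedding.SmoothnessFacts]`.) [cite: GPV2000] -/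
def HasGaussDiagram.reverse : Prop :=
  ∀ [SphereEmbedding.SmoothnessFacts] {K : Knot} {G : GaussDiagram}, K.HasGaussDiagram G →
    K.reverse.HasGaussDiagram G.reverse

/-- The mirror image of a knot has the mirrored Gauss diagram, up to isotopy: reflecting
`𝕊 3 ∖ {northPole} ≅ ℝ² × ℝ` in the projection plane (`height ↦ -height`) keeps the plane
curve, swaps over- and under-passages and negates all signs, and the reflected knot is
isotopic to `K.mirror` (any two orientation-reversing diffeomorphisms of `𝕊 3` are isotopic,
Cerf 1968). GPV (2000), §1.4; Rolfsen (1976), §3.C. (The literal diagram of `K.mirror`, the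
reflection in `x₃`, is the projection of `K` from the south pole, a different diagram.)
(`Knot.mirror` consumes `[SphereEmbedding.SmoothnessFacts]`.) [cite: Cerf1968] -/
def HasGaussDiagram.mirror : Prop :=
  ∀ [SphereEmbedding.SmoothnessFacts] {K : Knot} {G : GaussDiagram}, K.HasGaussDiagram G →
    ∃ K' : Knot, K.mirror.IsIsotopic K' ∧ K'.HasGaussDiagram G.mirror

/-- A Gauss diagram of a knot and a Gauss diagram of (a knot isotopic to) its mirror image
that is the mirrored diagram have opposite writhes; conditional on the named fact
`HasGaussDiagram.mirror` (hypothesis `hmirror`). Kauffman (1987), Ch. II. [cite: Kauffman1987] -/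
theorem HasGaussDiagram.writhe_mirror [SphereEmbedding.SmoothnessFacts]
    (hmirror : HasGaussDiagram.mirror) {K : Knot} {G : GaussDiagram}
    (h : K.HasGaussDiagram G) :
    ∃ K' : Knot, K.mirror.IsIsotopic K' ∧ ∃ G', K'.HasGaussDiagram G' ∧
      G'.writhe = -G.writhe := by
  obtain ⟨K', hK', hG'⟩ := hmirror h
  exact ⟨K', hK', G.mirror, hG', G.writhe_mirror⟩

end Knot

/-- The standard **unknot** `t ↦ (cos t, sin t, 0, 0)` is in regular position with no
crossing: its plane curve is the unit circle `t ↦ (cos t, sin t)`, an injective immersion on a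
period, so it has the empty Gauss diagram. Rolfsen (1976), §1.A. (`unknot` consumes
`[SphereEmbedding.SmoothnessFacts]`.) [cite: Rolfsen1976] -/
def unknot_hasGaussDiagram_empty : Prop :=
  ∀ [SphereEmbedding.SmoothnessFacts], unknot.HasGaussDiagram GaussDiagram.empty

/-- Some unknotted knot has the empty Gauss diagram (namely the standard unknot, by the named
fact `unknot_hasGaussDiagram_empty`, hypothesis `hu`). Rolfsen (1976), §1.A. [cite: Rolfsen1976] -/
theorem hasGaussDiagram_unknot_empty [SphereEmbedding.SmoothnessFacts]
    (hu : unknot_hasGaussDiagram_empty) :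
    ∃ K : Knot, K.IsUnknot ∧ K.HasGaussDiagram GaussDiagram.empty :=
  ⟨unknot, isUnknot_unknot, hu⟩

/-- A knot is unknotted iff each (equivalently, some) of its Gauss diagrams is *Polyak*
equivalent (`GaussDiagram.Equiv`) to the empty diagram — conditional on the OPEN statement
`Knot.reidemeister` (`hR`; its direction `→` is the open question of Audoux–Fiedler (2005),
§1) and on the named fact `unknot_hasGaussDiagram_empty` (`hu`). With Reidemeister equivalence
`GaussDiagram.REquiv` (`GaussDiagramsRMoves`) in place of `Equiv` this is Reidemeister (1927),
Polyak (2010), Thm. 1.2 and GPV (2000), Thm. 1.B. [cite: AudouxFiedler2005, §1 (Question)] -/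
theorem Knot.HasGaussDiagram.isUnknot_iff [SphereEmbedding.SmoothnessFacts]
    (hR : Knot.reidemeister) (hu : unknot_hasGaussDiagram_empty) {K : Knot} {G : GaussDiagram}
    (h : K.HasGaussDiagram G) : K.IsUnknot ↔ G.Equiv GaussDiagram.empty :=
  hR h hu

end Literature.Topology.FourManifolds
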